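import Summits.MatrixMultiplication.MatrixMultiplication.Theorems.ObstructionDescentUniversalOccurrenceTwoRectangleQuadFrontValue

set_option linter.dupNamespace false
set_option autoImplicit false

/-!
# Universal occurrence — two rectangles, THE FOUR-ROW FAMILY `(2N-2k-6, 2k+2, 2, 2)` FOR ALL `k` (decomp-mm · lens 3 · gen 43, part W)

Route `route-MatrixMultiplication-ObstructionDescent` (sub-problem `MatrixMultiplication`, `ω(ℂ) = 2`); SUPPORT for the crux
`NoOccurrenceObstruction` (`P_O`, item `stmt-MatrixMultiplication-29040`) through the universal-occurrence programme (NODE-g29…g43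
of the decomp-mm cell, lens 3).  Nothing here proves `ω = 2` or closes an item; no `def`, no `sorry`, standard axioms.

**Main theorem** (`occurs_unitTensor_twoRectangle_fourRowsTwoTwo`).  For all `k ≥ 0` and `m ≥ N ≥ 2k + 4`,
`((2^N),(2^N),(2N-2k-6, 2k+2, 2, 2))` OCCURS in `ℂ[GL×GL×GL · ⟨m⟩^{⊗ 2N}]`: the third TWO-PARAMETER family of Kronecker-positive
types of the two-rectangular sector shown to occur for the unit tensor (`k = 0` is `(2N-6,2,2,2)`, `k = 1` the type `(2N-8,4,2,2)`
of part G).  Assembly exactly as in parts C/G/J/O/S: K23 floor law (`δ = 2`, twist `H = {s₁, s₃}`) with the quad-front design,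
every valid term `∈ {0,1}` (part V), invalid terms vanish (`sign_mul_wordBlockSign_twist`), and the witness
`σ₀ = (s₁ s₂)`, `σ₁ = (s₀ s₁ s₃ s₂) · ∏_{j<k} (s_{2j+4} s_{2j+5})` reproduces the row word of `T`.

[cite: BurgisserIkenmeyer2011, §3.4 (Prop. 3.4), Thm. 4.4] [cite: BurgisserIkenmeyer2017, §5, Thm. 5.9 (proof of (2)), eq. (3.4)]
[cite: BurgisserChristandlIkenmeyer2011, Thm. 1 with proof]
-/

noncomputable section

open scoped BigOperators

namespace Summit.MatrixMultiplication.MatrixMultiplication.Theorems.ObstructionCalculus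

open Literature.Computability.AlgebraicComplexity
open Literature.NumberTheory.DiophantineGeometry

set_option maxHeartbeats 800000 in
/-- **The witness.**  `σ₀ = (s₁ s₂)`, `σ₁ : s₀ ↦ s₁ ↦ s₃ ↦ s₂ ↦ s₀` times `∏_{j<k} (s_{2j+4} s_{2j+5})`: the term is VALID for the
twist `H = {s₁, s₃}` and `g ∘ w_σ` is the row word of `T`, so `e_T(g ∘ w_σ) = 1 ≠ 0`. [folklore] -/
theorem quadFront_witness {N k : ℕ} (hN : 2 * k + 4 ≤ N) {Y : YoungDiagram}
    (hNY : ∀ x ∈ Y.cells, x.1 < N) (T : StdFilling (N * 2) Y)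
    (hT : ∀ p : Fin (N * 2), T.1 p = (if (p : ℕ) < 8 then ((p : ℕ) % 4, (p : ℕ) / 4)
      else if (p : ℕ) < 4 * k + 8 then ((p : ℕ) % 2, (p : ℕ) / 2 - 2) else (0, (p : ℕ) - 2 * k - 6)))
    (e : Fin (N * 2) ≃ Fin 2 × Fin N) (g : Fin N → Fin N)
    (hgv : ∀ i : Fin N, ((g i : Fin N) : ℕ) = if (i : ℕ) < 4 then (i : ℕ)
      else if ((i : ℕ) < 2 * k + 4 ∧ (i : ℕ) % 2 = 1) then 1 else 0)
    (hpos : ∀ (σ : Fin 2 → Equiv.Perm (Fin N)) (n : ℕ) (hn : n < N * 2) (a : Fin 2) (s : Fin N),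
      (if (4 ≤ n ∧ n < 8 ∧ n % 2 = 0) then n + 1 else if (4 ≤ n ∧ n < 8 ∧ n % 2 = 1) then n - 1
        else if (8 ≤ n ∧ n < 4 * k + 8 ∧ n % 4 = 2) then n + 1
        else if (8 ≤ n ∧ n < 4 * k + 8 ∧ n % 4 = 3) then n - 1 else n) % 2 = (a : ℕ) →
      (if (4 ≤ n ∧ n < 8 ∧ n % 2 = 0) then n + 1 else if (4 ≤ n ∧ n < 8 ∧ n % 2 = 1) then n - 1
        else if (8 ≤ n ∧ n < 4 * k + 8 ∧ n % 4 = 2) then n + 1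
        else if (8 ≤ n ∧ n < 4 * k + 8 ∧ n % 4 = 3) then n - 1 else n) / 2 = (s : ℕ) →
      (g ∘ fun q => σ (e q).1 (e q).2) ⟨n, hn⟩ = g (σ a s))
    (H : Finset (Fin N)) (hHv : ∀ s : Fin N, s ∈ H ↔ ((s : ℕ) = 1 ∨ (s : ℕ) = 3)) :
    ∃ σw : Fin 2 → Equiv.Perm (Fin N), (∀ s, (σw 0)⁻¹ (σw 1 s) ∈ H ↔ s ∈ H) ∧
      T.polytabloid ℂ hNY (g ∘ fun q => σw (e q).1 (e q).2) ≠ 0 := by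
  classical
  have hrowT : ∀ q : Fin (N * 2), (T.1 q).1 =
      if (q : ℕ) < 8 then (q : ℕ) % 4 else if (q : ℕ) < 4 * k + 8 then (q : ℕ) % 2 else 0 := fun q => by
    rw [hT]; split_ifs <;> rfl
  -- `σ₀ = (s₁ s₂)` and `σ₁`, given by their values
  obtain ⟨S0, hS0⟩ : ∃ S : Fin N → Fin N, ∀ s : Fin N, ((S s : Fin N) : ℕ) =
      if (s : ℕ) = 1 then 2 else if (s : ℕ) = 2 then 1 else (s : ℕ) :=
    ⟨fun s => ⟨if (s : ℕ) = 1 then 2 else if (s : ℕ) = 2 then 1 else (s : ℕ), by have := s.2; split_ifs <;> omega⟩,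
      fun s => rfl⟩
  have hS0i : Function.Involutive S0 := by
    intro s; apply Fin.ext; rw [hS0, hS0]; split_ifs <;> omega
  obtain ⟨S1, hS1⟩ : ∃ S : Fin N → Fin N, ∀ s : Fin N, ((S s : Fin N) : ℕ) =
      if (s : ℕ) = 0 then 1 else if (s : ℕ) = 1 then 3 else if (s : ℕ) = 2 then 0 else if (s : ℕ) = 3 then 2
      else if (s : ℕ) < 2 * k + 4 then (if (s : ℕ) % 2 = 0 then (s : ℕ) + 1 else (s : ℕ) - 1) else (s : ℕ) :=
    ⟨fun s => ⟨if (s : ℕ) = 0 then 1 else if (s : ℕ) = 1 then 3 else if (s : ℕ) = 2 then 0 else if (s : ℕ) = 3 then 2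
      else if (s : ℕ) < 2 * k + 4 then (if (s : ℕ) % 2 = 0 then (s : ℕ) + 1 else (s : ℕ) - 1) else (s : ℕ),
      by have := s.2; split_ifs <;> omega⟩, fun s => rfl⟩
  have hS1inj : Function.Injective S1 := by
    intro s t h
    have h' := congrArg Fin.val h
    rw [hS1, hS1] at h'
    apply Fin.ext
    split_ifs at h' <;> omega
  obtain ⟨σw, hw0, hw1⟩ : ∃ σw : Fin 2 → Equiv.Perm (Fin N), σw 0 = Function.Involutive.toPerm S0 hS0i ∧
      σw 1 = Equiv.ofBijective S1 (Finite.injective_iff_bijective.1 hS1inj) :=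
    ⟨![Function.Involutive.toPerm S0 hS0i, Equiv.ofBijective S1 (Finite.injective_iff_bijective.1 hS1inj)], rfl, rfl⟩
  have hsw0 : ∀ s : Fin N, ((σw 0 s : Fin N) : ℕ) =
      if (s : ℕ) = 1 then 2 else if (s : ℕ) = 2 then 1 else (s : ℕ) := by
    intro s; rw [hw0]; exact hS0 s
  have hsw1 : ∀ s : Fin N, ((σw 1 s : Fin N) : ℕ) =
      if (s : ℕ) = 0 then 1 else if (s : ℕ) = 1 then 3 else if (s : ℕ) = 2 then 0 else if (s : ℕ) = 3 then 2
      else if (s : ℕ) < 2 * k + 4 then (if (s : ℕ) % 2 = 0 then (s : ℕ) + 1 else (s : ℕ) - 1) else (s : ℕ) := by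
    intro s; rw [hw1]; exact hS1 s
  refine ⟨σw, ?_, ?_⟩
  · -- validity for the twist `H = {s₁, s₃}`
    intro s
    have hi0 : ∀ x, σw 0 ((σw 0)⁻¹ x) = x := fun x => (σw 0).apply_symm_apply x
    set t := (σw 0)⁻¹ (σw 1 s) with ht
    have h1 : ((σw 0 t : Fin N) : ℕ) = ((σw 1 s : Fin N) : ℕ) := by rw [ht, hi0]
    rw [hsw0, hsw1] at h1
    rw [hHv, hHv]
    split_ifs at h1 <;> omega
  · -- `g ∘ w_σ = w_T`
    have hwrd : (g ∘ fun q => σw (e q).1 (e q).2) = StdFilling.rowWord hNY T := by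
      funext q
      obtain ⟨n, hn⟩ := q
      apply Fin.ext
      show _ = (T.1 ⟨n, hn⟩).1
      rw [hrowT]
      dsimp only
      obtain ⟨X, hXdef⟩ : ∃ X : ℕ,
          X = (if (4 ≤ n ∧ n < 8 ∧ n % 2 = 0) then n + 1 else if (4 ≤ n ∧ n < 8 ∧ n % 2 = 1) then n - 1
            else if (8 ≤ n ∧ n < 4 * k + 8 ∧ n % 4 = 2) then n + 1
            else if (8 ≤ n ∧ n < 4 * k + 8 ∧ n % 4 = 3) then n - 1 else n) := ⟨_, rfl⟩
      have hposn := hpos σw n hn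
      rw [← hXdef] at hposn
      have hX2 : X < N * 2 := by rw [hXdef]; split_ifs <;> omega
      rw [hposn ⟨X % 2, by omega⟩ ⟨X / 2, by omega⟩ rfl rfl, hgv]
      -- separate the front (`n < 8`) from the pairs and the arm, to keep the case analysis small
      by_cases hn8 : n < 8
      · rw [if_neg (show ¬(8 ≤ n ∧ n < 4 * k + 8 ∧ n % 4 = 2) by omega),
          if_neg (show ¬(8 ≤ n ∧ n < 4 * k + 8 ∧ n % 4 = 3) by omega)] at hXdef
        rw [if_pos hn8]
        rcases Nat.mod_two_eq_zero_or_one X with h | h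
        · rw [show (⟨X % 2, by omega⟩ : Fin 2) = 0 from Fin.ext h, hsw0]
          dsimp only
          split_ifs at hXdef ⊢ <;> omega
        · rw [show (⟨X % 2, by omega⟩ : Fin 2) = 1 from Fin.ext h, hsw1]
          dsimp only
          split_ifs at hXdef ⊢ <;> omega
      · rw [if_neg (show ¬(4 ≤ n ∧ n < 8 ∧ n % 2 = 0) by omega),
          if_neg (show ¬(4 ≤ n ∧ n < 8 ∧ n % 2 = 1) by omega)] at hXdef
        rw [if_neg hn8]
        rcases Nat.mod_two_eq_zero_or_one X with h | h
        · rw [show (⟨X % 2, by omega⟩ : Fin 2) = 0 from Fin.ext h, hsw0]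
          dsimp only
          split_ifs at hXdef ⊢ <;> omega
        · rw [show (⟨X % 2, by omega⟩ : Fin 2) = 1 from Fin.ext h, hsw1]
          dsimp only
          split_ifs at hXdef ⊢ <;> omega
    rw [hwrd, StdFilling.polytabloid_apply_rowWord]
    exact one_ne_zero

set_option maxHeartbeats 400000 in
/-- **`((2^N),(2^N),(2N-2k-6,2k+2,2,2))` occurs for `⟨m⟩` for all `k` and `m ≥ N ≥ 2k+4**, uniformly in `k` and `N`: the third
two-parameter family of the two-rectangular sector (`k = 0`: `(2N-6,2,2,2)`; `k = 1`: `(2N-8,4,2,2)`, part G).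
[cite: BurgisserIkenmeyer2011, Thm. 4.4] [cite: BurgisserIkenmeyer2017, Thm. 5.9 (proof of (2))] -/
theorem occurs_unitTensor_twoRectangle_fourRowsTwoTwo {N m k : ℕ} (hN : 2 * k + 4 ≤ N) (hNm : N ≤ m)
    {lam : Fin 3 → Nat.Partition (N * 2)} (h0 : lam 0 = Nat.Partition.rectangle N 2)
    (h1 : lam 1 = Nat.Partition.rectangle N 2) (h2 : (lam 2).sortedParts = [2 * N - 2 * k - 6, 2 * k + 2, 2, 2]) :
    isotypicSum₁ (lam 0) (isotypicSum₂ (lam 1) (isotypicSum₃ (lam 2)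
      (kroneckerPow (unitTensor ℂ m) (N * 2)))) ≠ 0 := by
  classical
  -- the shape and the quad-front tableau `T`
  have hNY : ∀ x ∈ (lam 2).youngDiagram.cells, x.1 < N := fun x hx => by
    have := fst_lt_of_mem_youngDiagram_fourRowsTwoTwo (lam 2) h2 hx; omega
  have hd : (lam 2).youngDiagram.cells.card = N * 2 := Nat.Partition.card_cells_youngDiagram _
  obtain ⟨T, hT⟩ : ∃ T : StdFilling (N * 2) (lam 2).youngDiagram, ∀ p : Fin (N * 2), T.1 p =
      (if (p : ℕ) < 8 then ((p : ℕ) % 4, (p : ℕ) / 4)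
        else if (p : ℕ) < 4 * k + 8 then ((p : ℕ) % 2, (p : ℕ) / 2 - 2) else (0, (p : ℕ) - 2 * k - 6)) :=
    ⟨⟨fun p => if (p : ℕ) < 8 then ((p : ℕ) % 4, (p : ℕ) / 4)
        else if (p : ℕ) < 4 * k + 8 then ((p : ℕ) % 2, (p : ℕ) / 2 - 2) else (0, (p : ℕ) - 2 * k - 6),
      ⟨fun p => quadFrontCell_mem_fourRowsTwoTwo hN (lam 2) h2 p p.2,
       fun p q hpq => Fin.ext (quadFrontCell_injective hpq),
       fun p q hpq => quadFrontCell_standard hpq⟩⟩, fun p => rfl⟩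
  have hM : StdFilling.polytabloid ℂ hNY T ∈
      highestWeightSpace (wordRep ℂ N (N * 2)) (Weight.ofPartition N (lam 2)) := by
    rw [← ydWeight_youngDiagram]; exact StdFilling.polytabloid_mem hNY T hd
  -- the slots `s₁, s₃`, the involution `X = (4 5)(6 7) ∏_{j<k} (4j+10 4j+11)` of the positions and the block structures
  obtain ⟨s1, hs1⟩ : ∃ s : Fin N, (s : ℕ) = 1 := ⟨⟨1, by omega⟩, rfl⟩
  obtain ⟨s3, hs3⟩ : ∃ s : Fin N, (s : ℕ) = 3 := ⟨⟨3, by omega⟩, rfl⟩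
  obtain ⟨Xf, hXf⟩ : ∃ Xf : Fin (N * 2) → Fin (N * 2), ∀ q : Fin (N * 2), ((Xf q : Fin (N * 2)) : ℕ) =
      (if (4 ≤ (q : ℕ) ∧ (q : ℕ) < 8 ∧ (q : ℕ) % 2 = 0) then (q : ℕ) + 1
        else if (4 ≤ (q : ℕ) ∧ (q : ℕ) < 8 ∧ (q : ℕ) % 2 = 1) then (q : ℕ) - 1
        else if (8 ≤ (q : ℕ) ∧ (q : ℕ) < 4 * k + 8 ∧ (q : ℕ) % 4 = 2) then (q : ℕ) + 1
        else if (8 ≤ (q : ℕ) ∧ (q : ℕ) < 4 * k + 8 ∧ (q : ℕ) % 4 = 3) then (q : ℕ) - 1 else (q : ℕ)) :=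
    ⟨fun q => ⟨(if (4 ≤ (q : ℕ) ∧ (q : ℕ) < 8 ∧ (q : ℕ) % 2 = 0) then (q : ℕ) + 1
        else if (4 ≤ (q : ℕ) ∧ (q : ℕ) < 8 ∧ (q : ℕ) % 2 = 1) then (q : ℕ) - 1
        else if (8 ≤ (q : ℕ) ∧ (q : ℕ) < 4 * k + 8 ∧ (q : ℕ) % 4 = 2) then (q : ℕ) + 1
        else if (8 ≤ (q : ℕ) ∧ (q : ℕ) < 4 * k + 8 ∧ (q : ℕ) % 4 = 3) then (q : ℕ) - 1 else (q : ℕ)),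
      by have := q.2; split_ifs <;> omega⟩, fun q => rfl⟩
  have hXi : Function.Involutive Xf := by
    intro q; apply Fin.ext; rw [hXf, hXf]; split_ifs <;> omega
  obtain ⟨ξ, hξ⟩ : ∃ ξ : Equiv.Perm (Fin (N * 2)), ξ = Function.Involutive.toPerm Xf hXi := ⟨_, rfl⟩
  have hξv : ∀ q : Fin (N * 2), ((ξ q : Fin (N * 2)) : ℕ) =
      (if (4 ≤ (q : ℕ) ∧ (q : ℕ) < 8 ∧ (q : ℕ) % 2 = 0) then (q : ℕ) + 1
        else if (4 ≤ (q : ℕ) ∧ (q : ℕ) < 8 ∧ (q : ℕ) % 2 = 1) then (q : ℕ) - 1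
        else if (8 ≤ (q : ℕ) ∧ (q : ℕ) < 4 * k + 8 ∧ (q : ℕ) % 4 = 2) then (q : ℕ) + 1
        else if (8 ≤ (q : ℕ) ∧ (q : ℕ) < 4 * k + 8 ∧ (q : ℕ) % 4 = 3) then (q : ℕ) - 1 else (q : ℕ)) := by
    intro q; rw [hξ]; exact hXf q
  obtain ⟨e, he⟩ : ∃ e : Fin (N * 2) ≃ Fin 2 × Fin N,
      e = ξ.trans (finProdFinEquiv.symm.trans (Equiv.prodComm (Fin N) (Fin 2))) := ⟨_, rfl⟩
  have hev : ∀ q : Fin (N * 2), (((e q).1 : Fin 2) : ℕ) = ((ξ q : Fin (N * 2)) : ℕ) % 2 ∧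
      (((e q).2 : Fin N) : ℕ) = ((ξ q : Fin (N * 2)) : ℕ) / 2 := by
    intro q; rw [he]; simp [Fin.modNat, Fin.divNat]
  -- the twist `H = {s₁, s₃}` and `e'`
  obtain ⟨H, hH⟩ : ∃ H : Finset (Fin N), H = {s1, s3} := ⟨_, rfl⟩
  have hHv : ∀ s : Fin N, s ∈ H ↔ ((s : ℕ) = 1 ∨ (s : ℕ) = 3) := by
    intro s; rw [hH, Finset.mem_insert, Finset.mem_singleton, Fin.ext_iff, Fin.ext_iff, hs1, hs3]
  let F : Fin 2 × Fin N → Fin 2 × Fin N := fun x => (if x.2 ∈ H then Fin.rev x.1 else x.1, x.2)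
  have hF : Function.Involutive F := by
    rintro ⟨a, s⟩; by_cases hs : s ∈ H <;> simp [F, hs, Fin.rev_rev]
  obtain ⟨e', he'⟩ : ∃ e' : Fin (N * 2) ≃ Fin 2 × Fin N,
      ∀ q, e' q = (if (e q).2 ∈ H then Fin.rev (e q).1 else (e q).1, (e q).2) :=
    ⟨e.trans (Function.Involutive.toPerm F hF), fun q => rfl⟩
  -- the colouring `g = (0,1,2,3, 0,1, 0,1, …, 0,…)` (`k` pairs)
  obtain ⟨g, hg⟩ : ∃ g : Fin N → Fin N, ∀ i, g i = if (i : ℕ) < 4 then i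
      else if ((i : ℕ) < 2 * k + 4 ∧ (i : ℕ) % 2 = 1) then s1 else ⟨0, by omega⟩ := ⟨_, fun i => rfl⟩
  have hgv : ∀ i : Fin N, ((g i : Fin N) : ℕ) = if (i : ℕ) < 4 then (i : ℕ)
      else if ((i : ℕ) < 2 * k + 4 ∧ (i : ℕ) % 2 = 1) then 1 else 0 := by
    intro i; rw [hg]; split_ifs <;> simp [hs1]
  -- evaluation of the words `g ∘ w_σ` at the positions
  have hpos : ∀ (σ : Fin 2 → Equiv.Perm (Fin N)) (n : ℕ) (hn : n < N * 2) (a : Fin 2) (s : Fin N),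
      (if (4 ≤ n ∧ n < 8 ∧ n % 2 = 0) then n + 1 else if (4 ≤ n ∧ n < 8 ∧ n % 2 = 1) then n - 1
        else if (8 ≤ n ∧ n < 4 * k + 8 ∧ n % 4 = 2) then n + 1
        else if (8 ≤ n ∧ n < 4 * k + 8 ∧ n % 4 = 3) then n - 1 else n) % 2 = (a : ℕ) →
      (if (4 ≤ n ∧ n < 8 ∧ n % 2 = 0) then n + 1 else if (4 ≤ n ∧ n < 8 ∧ n % 2 = 1) then n - 1
        else if (8 ≤ n ∧ n < 4 * k + 8 ∧ n % 4 = 2) then n + 1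
        else if (8 ≤ n ∧ n < 4 * k + 8 ∧ n % 4 = 3) then n - 1 else n) / 2 = (s : ℕ) →
      (g ∘ fun q => σ (e q).1 (e q).2) ⟨n, hn⟩ = g (σ a s) := by
    intro σ n hn a s ha hs
    obtain ⟨h1, h2⟩ := hev ⟨n, hn⟩
    rw [hξv] at h1 h2
    dsimp only at h1 h2
    have ha' : (e ⟨n, hn⟩).1 = a := Fin.ext (by rw [h1, ha])
    have hs' : (e ⟨n, hn⟩).2 = s := Fin.ext (by rw [h2, hs])
    show g (σ (e ⟨n, hn⟩).1 (e ⟨n, hn⟩).2) = _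
    rw [ha', hs']
  -- the summands are `0` or `1`
  have hterm : ∀ σ : Fin 2 → Equiv.Perm (Fin N),
      (∏ a, ((Equiv.Perm.sign (σ a) : ℤ) : ℂ)) *
          (wordBlockSign ℂ e' (fun q => σ (e q).1 (e q).2) *
            ∑ w, StdFilling.polytabloid ℂ hNY T w *
              ∏ q, (fun i l : Fin N => if l = g i then (1 : ℂ) else 0) (σ (e q).1 (e q).2) (w q)) =
        if (∀ s, (σ 0)⁻¹ (σ 1 s) ∈ H ↔ s ∈ H) ∧
            StdFilling.polytabloid ℂ hNY T (g ∘ fun q => σ (e q).1 (e q).2) ≠ 0 then 1 else 0 := by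
    intro σ
    have hc : (∑ w, StdFilling.polytabloid ℂ hNY T w *
        ∏ q, (fun i l : Fin N => if l = g i then (1 : ℂ) else 0) (σ (e q).1 (e q).2) (w q)) =
        StdFilling.polytabloid ℂ hNY T (g ∘ fun q => σ (e q).1 (e q).2) :=
      sum_mul_prod_indicator_eq _ g _
    rw [hc, ← mul_assoc, sign_mul_wordBlockSign_twist e e' H he' σ]
    by_cases hval : ∀ s, (σ 0)⁻¹ (σ 1 s) ∈ H ↔ s ∈ H
    · rw [if_pos hval, one_mul]
      by_cases hz : StdFilling.polytabloid ℂ hNY T (g ∘ fun q => σ (e q).1 (e q).2) = 0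
      · rw [if_neg (fun h => h.2 hz), hz]
      · rw [if_pos ⟨hval, hz⟩]
        exact quadFront_value_eq_one hN hNY T hT e g hgv hpos H hHv s1 s3 hs1 hs3 σ hval hz
    · rw [if_neg hval, zero_mul, if_neg (fun h => hval h.1)]
  refine occurs_unitTensor_twoRectangle_of_pairing_ne_zero hNm e e' h0 h1 hM
    (fun i l => if l = g i then (1 : ℂ) else 0) ?_
  intro hsum
  rw [Finset.sum_congr rfl (fun σ _ => hterm σ), Finset.sum_boole, Nat.cast_eq_zero,
    Finset.card_eq_zero, Finset.filter_eq_empty_iff] at hsum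
  obtain ⟨σw, hvalid, hne⟩ := quadFront_witness hN hNY T hT e g hgv hpos H hHv
  exact hsum (Finset.mem_univ σw) ⟨hvalid, hne⟩

end Summit.MatrixMultiplication.MatrixMultiplication.Theorems.ObstructionCalculus
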